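import Summits.CriticalPhenomena.PercolationContinuityZ3.Theorems.PercNearOneGluingNoHeavyRsw3AnnulusDecoupling
import HarnessLib

/-!
# RSW3 lane (P2, method "3D RSW-lite from continuity"): the annulus crossing window at EVERY aspect
# ratio — `P_{p_c}(Λ(L) ↔ ∂ⁱⁿΛ(N) in Λ(N)) ≥ (2d)⁻¹ (L/4N)^{d-1}` for all `1 ≤ L ≤ N`, `d ≥ 2`

builds on p205010 (kernel theorem, internal audit signed; external expert review pending)

Cell `prim-rsw3` (post-continuity programme, LANE 3 "box crossing / quasi-multiplicativity at
`p_c(ℤ³)`"), prover seat `prim-rsw3-p2` (gen 2), memo `run/shared/lean/prim/rsw3/P2-RSWLITE.md` §7.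
Support file (`--supports stmt-CriticalPhenomena-4575`); no definitions, no named facts, no sorries.

The tree's a-priori window for the annulus events `u_p(L,N) = P_p(boxCrossing d L N) =
P_p(Λ(L) ↔ ∂ⁱⁿΛ(N) in Λ(N))` is stated at aspect ratio `N/L ≤ 4` (`85^{-d} ≤ u_{p_c}(L, 4L)`,
`SurfaceTension.le_crossProb_criticalProbI`, from the scale recursion `u(4L) ≤ 85^d u(L)²`).  This file
proves the two-parameter form, uniform in the inner scale and POLYNOMIAL in the aspect ratio, from the
one-step decoupling `u_p(L,R) ≤ C(L,N) u_p(L,N) u_p(L, R-(N+L+2))`, `C(L,N) = 2d (4N/L)^{d-1}`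
(`Rsw3.real_boxCrossing_le_mul`, file `…Rsw3AnnulusDecoupling`):

* `real_boxCrossing_iter_le` — iterating, `u_p(L, (k+1)(N+2L+2)) ≤ C^k u_p(L,N)^{k+1}`.
* `theta_eq_zero_of_real_boxCrossing_lt` — **finite-size criterion at every aspect ratio (all `p`,
  all `d`)**: if `2d (4N/L)^{d-1} · u_p(L,N) < 1` for ONE pair `1 ≤ L ≤ N` then `θ(p) = 0` (indeed
  `u_p(L, ·)`, hence `π_p`, decays exponentially) — Kesten's sponge-crossing criterion (Thm. 5.1) in
  annulus form with the aspect ratio free; with the inner box a point it is Hammersley's criterion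
  `π_p(N) |∂Λ(N)| < 1`.
* `le_real_boxCrossing_criticalProbI_of_le` — **at `p_c(ℤ^d)`, `d ≥ 2`, for all `1 ≤ L ≤ N`:
  `(2d)⁻¹ (L/(4N))^{d-1} ≤ P_{p_c}(Λ(L) ↔ ∂ⁱⁿΛ(N) in Λ(N))`** (`u_p` is continuous in `p` and `θ > 0` on
  `(p_c, 1]`, where the criterion therefore fails); `d = 3`: `(L/N)²/96 ≤ P_{p_c(ℤ³)}(Λ(L) ↔ ∂ⁱⁿΛ(N) in Λ(N))`
  (`le_real_boxCrossing_criticalProbI_three_of_le`); fixed aspect ratio `λ ≥ 1`: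
  `(2d)⁻¹ (4λ)^{-(d-1)} ≤ P_{p_c}(boxCrossing d n (λ n))` for every `n ≥ 1`
  (`le_real_boxCrossing_mul_criticalProbI`; `d = 3`: `1/(96 λ²)`, `le_real_boxCrossing_mul_criticalProbI_three`)
  — the lane's row (S1-lo-ann) at EVERY aspect ratio, with the explicit polynomial dependence
  `λ^{-(d-1)}` (the exponent of Hammersley's one-arm bound `π_{p_c}(N) ≥ c N^{-(d-1)}`, the case of a
  fixed inner box).  At `λ = 4` the constant `1/1536` improves the tree's `85^{-3}`.
* `pow_le_of_real_boxCrossing_criticalProbI_le` — contrapositive reading for LANE 1's defect scale: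
  `u_{p_c}(L,N) ≤ δ` forces `L^{d-1} ≤ 2d δ (4N)^{d-1}`, i.e. `F(L) ≥ (L/4)(2dδ)^{-1/(d-1)}` — the defect
  scale is at least LINEAR in `L` (gen 1 had only `F > 4L` below the window `85^{-d}`).

Honest size: classical (a finite-size criterion of Hammersley 1957 / Kesten 1982 type; the explicit
two-parameter form, uniform in `L`, and its kernel proof are the additions); dimension-free, hence silent
on the hyperscaling side (upper bounds `< 1`: X_B = `CritAnnulusNonCrossing`, barrier
`SpanningClustersAboveSix`) and on HARD-direction box crossings; at `p_c(ℤ³)` the decay in `λ` is expected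
to be `λ^{-0.48}` (one-arm exponent; numerically, lane census CENSUS-QM.md), against the proved `λ^{-2}`.

References: H. Kesten, *Percolation Theory for Mathematicians* (1982), Thm. 5.1, Cor. 5.1; J. M.
Hammersley, Ann. Math. Statist. 28 (1957) 790–795; M. V. Menshikov (1986) / M. Aizenman, D. Barsky (1987)
(`p_T = p_H`, used through the tree's `theta_pos_of_criticalProb_lt_holds` only in the form `θ > 0` above
`p_c`); G. Grimmett, *Percolation* (1999), §5.2, §11.7. [folklore]
-/

noncomputable section

namespace Summit.CriticalPhenomena.PercolationContinuityZ3.Theorems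

open MeasureTheory ProbabilityTheory Filter Topology
open Literature.Probability.Percolation Literature.Probability.LatticeModels
open Literature.Probability.Percolation.CerfDembinVanishing

namespace Rsw3

open SurfaceTension

variable {d : ℕ}

/-! ## Iteration and the finite-size criterion -/

/-- **Iterated decoupling.** With `s = N + 2L + 2` and `C = 2d (4N/L)^{d-1}`:
`u_p(L, (k+1) s) ≤ C^k · u_p(L, N)^{k+1}` for every `k`. -/
theorem real_boxCrossing_iter_le (p : unitInterval) {L N : ℕ} (hL : 1 ≤ L) (hLN : L ≤ N) (k : ℕ) :
    (bondPercolation (zdGraph d) p).real (boxCrossing d L ((k + 1) * (N + 2 * L + 2))) ≤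
      (2 * d * (4 * (N : ℝ) / L) ^ (d - 1)) ^ k *
        (bondPercolation (zdGraph d) p).real (boxCrossing d L N) ^ (k + 1) := by
  set μ := bondPercolation (zdGraph d) p with hμ
  set s := N + 2 * L + 2 with hs
  set C : ℝ := 2 * d * (4 * (N : ℝ) / L) ^ (d - 1) with hC
  have hC0 : 0 ≤ C := by positivity
  induction k with
  | zero =>
    have hanti : μ.real (boxCrossing d L (1 * s)) ≤ μ.real (boxCrossing d L N) :=
      measureReal_mono (fun ω hω => boxCrossing_anti hLN (by rw [one_mul, hs]; omega) hω)
    simpa using hanti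
  | succ k ih =>
    have hks : s ≤ (k + 1) * s := Nat.le_mul_of_pos_left s (by omega)
    have hR : N + 2 * L + 2 ≤ (k + 1 + 1) * s := by
      have : s ≤ (k + 1 + 1) * s := Nat.le_mul_of_pos_left s (by omega)
      simpa only [hs] using this
    have hstep := real_boxCrossing_le_mul (d := d) p hL hLN hR
    have hsub : (k + 1 + 1) * s - (N + L + 2) = (k + 1) * s + L := by
      have h1 : (k + 1 + 1) * s = (k + 1) * s + s := by ring
      rw [h1, hs]
      omega
    rw [hsub] at hstep
    have hLks : L ≤ (k + 1) * s := le_trans (by omega) hks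
    have hanti : μ.real (boxCrossing d L ((k + 1) * s + L)) ≤
        μ.real (boxCrossing d L ((k + 1) * s)) :=
      measureReal_mono (fun ω hω => boxCrossing_anti hLks (Nat.le_add_right _ _) hω)
    have hu0 : 0 ≤ μ.real (boxCrossing d L N) := measureReal_nonneg
    calc μ.real (boxCrossing d L ((k + 1 + 1) * s))
        ≤ C * (μ.real (boxCrossing d L N) * μ.real (boxCrossing d L ((k + 1) * s + L))) := hstep
      _ ≤ C * (μ.real (boxCrossing d L N) * μ.real (boxCrossing d L ((k + 1) * s))) :=
          mul_le_mul_of_nonneg_left (mul_le_mul_of_nonneg_left hanti hu0) hC0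
      _ ≤ C * (μ.real (boxCrossing d L N) * (C ^ k * μ.real (boxCrossing d L N) ^ (k + 1))) :=
          mul_le_mul_of_nonneg_left (mul_le_mul_of_nonneg_left ih hu0) hC0
      _ = C ^ (k + 1) * μ.real (boxCrossing d L N) ^ (k + 1 + 1) := by ring

/-- `θ(p) ≤ u_p(L, R)` for `L ≤ R`: the origin's infinite cluster crosses every annulus around it. -/
theorem theta_le_real_boxCrossing (p : unitInterval) {L R : ℕ} (hLR : L ≤ R) :
    theta (zdGraph d) 0 p ≤ (bondPercolation (zdGraph d) p).real (boxCrossing d L R) := by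
  have h1 : (percolatesAt (0 : Site d) : Set (BondConfig (Site d))) ⊆ boxToInfinity d L :=
    fun ω hω => ⟨0, zero_mem_box d L, hω⟩
  calc theta (zdGraph d) 0 p = (bondPercolation (zdGraph d) p).real (percolatesAt (0 : Site d)) := rfl
    _ ≤ (bondPercolation (zdGraph d) p).real (boxToInfinity d L) := measureReal_mono h1
    _ ≤ (bondPercolation (zdGraph d) p).real (boxCrossing d L R) :=
        real_boxToInfinity_le_real_boxCrossing p hLR

/-- **Finite-size criterion at every aspect ratio.** If `2d (4N/L)^{d-1} · u_p(L, N) < 1` for one pair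
`1 ≤ L ≤ N`, then `θ(p) = 0` (indeed `u_p(L, ·)` and hence `π_p` decay exponentially).
[cite: Kesten1982, Thm. 5.1] -/
theorem theta_eq_zero_of_real_boxCrossing_lt (p : unitInterval) {L N : ℕ} (hL : 1 ≤ L) (hLN : L ≤ N)
    (h : 2 * d * (4 * (N : ℝ) / L) ^ (d - 1) *
      (bondPercolation (zdGraph d) p).real (boxCrossing d L N) < 1) :
    theta (zdGraph d) 0 p = 0 := by
  set C : ℝ := 2 * d * (4 * (N : ℝ) / L) ^ (d - 1) with hC
  set u : ℝ := (bondPercolation (zdGraph d) p).real (boxCrossing d L N) with hu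
  have hC0 : 0 ≤ C := by positivity
  have hu0 : 0 ≤ u := measureReal_nonneg
  have ha0 : 0 ≤ C * u := by positivity
  have hpow : Tendsto (fun k : ℕ => u * (C * u) ^ k) atTop (𝓝 0) := by
    simpa using (tendsto_pow_atTop_nhds_zero_of_lt_one ha0 h).const_mul u
  have hθ : ∀ k : ℕ, theta (zdGraph d) 0 p ≤ u * (C * u) ^ k := fun k =>
    calc theta (zdGraph d) 0 p
        ≤ (bondPercolation (zdGraph d) p).real (boxCrossing d L ((k + 1) * (N + 2 * L + 2))) :=
          theta_le_real_boxCrossing p (by nlinarith)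
      _ ≤ C ^ k * u ^ (k + 1) := real_boxCrossing_iter_le p hL hLN k
      _ = u * (C * u) ^ k := by ring
  have hle : theta (zdGraph d) 0 p ≤ 0 := ge_of_tendsto' hpow hθ
  have hθ0 : 0 ≤ theta (zdGraph d) 0 p := measureReal_nonneg
  linarith

/-! ## At `p_c`: the window at every aspect ratio -/

/-- **The annulus crossing window at every aspect ratio (`d ≥ 2`).** For all `1 ≤ L ≤ N`:
`(2d)⁻¹ (L/(4N))^{d-1} ≤ P_{p_c}(Λ(L) ↔ ∂ⁱⁿΛ(N) in Λ(N))`.  (`u_p(L,N)` is continuous in `p`, and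
`θ > 0` on `(p_c, 1]`, where the finite-size criterion therefore fails.) [cite: Kesten1982, Cor. 5.1] -/
theorem le_real_boxCrossing_criticalProbI_of_le (hd : 2 ≤ d) {L N : ℕ} (hL : 1 ≤ L) (hLN : L ≤ N) :
    (2 * (d : ℝ))⁻¹ * ((L : ℝ) / (4 * N)) ^ (d - 1) ≤
      (bondPercolation (zdGraph d) (criticalProbI d)).real (boxCrossing d L N) := by
  set C : ℝ := 2 * d * (4 * (N : ℝ) / L) ^ (d - 1) with hC
  have hL0 : (0 : ℝ) < L := by exact_mod_cast hL
  have hN0 : (0 : ℝ) < N := by exact_mod_cast (lt_of_lt_of_le hL hLN)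
  have hCpos : 0 < C := by positivity
  have hCinv : (2 * (d : ℝ))⁻¹ * ((L : ℝ) / (4 * N)) ^ (d - 1) = C⁻¹ := by
    rw [← inv_div (4 * (N : ℝ)) L, inv_pow, ← mul_inv]
  rw [hCinv]
  by_contra hlt
  push Not at hlt
  have h1 : C * (bondPercolation (zdGraph d) (criticalProbI d)).real (boxCrossing d L N) < 1 := by
    have := mul_lt_mul_of_pos_left hlt hCpos
    rwa [mul_inv_cancel₀ hCpos.ne'] at this
  -- continuity of `p ↦ C u_p(L,N)` at `p_c`
  have hcont : Continuous fun p : unitInterval =>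
      C * (bondPercolation (zdGraph d) p).real (boxCrossing d L N) :=
    continuous_const.mul (continuous_real_boxCrossing L N)
  obtain ⟨δ, hδ, hball⟩ := Metric.continuous_iff.1 hcont (criticalProbI d)
    (1 - C * (bondPercolation (zdGraph d) (criticalProbI d)).real (boxCrossing d L N)) (by linarith)
  -- a parameter slightly above `p_c`
  have hpc1 : criticalProb (zdGraph d) (0 : Site d) < 1 := criticalProb_zd_lt_one hd
  have hpc0 : 0 ≤ criticalProb (zdGraph d) (0 : Site d) := (criticalProb_mem_Icc _ _).1
  set t : ℝ := min (criticalProb (zdGraph d) (0 : Site d) + δ / 2) 1 with ht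
  have htI : t ∈ Set.Icc (0 : ℝ) 1 := ⟨le_min (by linarith) zero_le_one, min_le_right _ _⟩
  obtain ⟨p, hp⟩ : ∃ p : unitInterval, (p : ℝ) = t := ⟨⟨t, htI⟩, rfl⟩
  have hlt' : criticalProb (zdGraph d) (0 : Site d) < (p : ℝ) := by
    rw [hp]; exact lt_min (by linarith) hpc1
  have hle' : (p : ℝ) ≤ criticalProb (zdGraph d) (0 : Site d) + δ / 2 := by
    rw [hp]; exact min_le_left _ _
  have hdist : dist p (criticalProbI d) < δ := by
    rw [Subtype.dist_eq, Real.dist_eq, coe_criticalProbI, abs_of_pos (sub_pos.2 hlt')]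
    linarith
  have hnear := hball p hdist
  rw [Real.dist_eq] at hnear
  have hp1 : C * (bondPercolation (zdGraph d) p).real (boxCrossing d L N) < 1 := by
    have := (abs_sub_lt_iff.1 hnear).1
    linarith
  have hθ0 := theta_eq_zero_of_real_boxCrossing_lt p hL hLN hp1
  have hθpos := theta_pos_of_criticalProb_lt_holds (zdGraph d) 0 p hlt'
  linarith

/-- **The defect scale is at least linear.** If at `p_c(ℤ^d)`, `d ≥ 2`, the annulus `Λ(N) ∖ Λ(L)`
(`1 ≤ L ≤ N`) is crossed with probability at most `δ`, then `L^{d-1} ≤ 2d · δ · (4N)^{d-1}`, i.e.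
`N ≥ (L/4) (2dδ)^{-1/(d-1)}`: the defect scale `F_δ(L) = min {N : u_{p_c}(L,N) ≤ 1 - δ'}` of LANE 1
(`δ = 1 - δ'`) grows at least linearly in `L`, with slope `→ ∞` as the allowed crossing probability `δ → 0`
(census, non-rigorous, `d = 3`: `F_{1/4}(n)/n ≈ 16`). [cite: Kesten1982, Cor. 5.1] -/
theorem pow_le_of_real_boxCrossing_criticalProbI_le (hd : 2 ≤ d) {L N : ℕ} (hL : 1 ≤ L) (hLN : L ≤ N)
    {δ : ℝ} (hδ : (bondPercolation (zdGraph d) (criticalProbI d)).real (boxCrossing d L N) ≤ δ) :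
    (L : ℝ) ^ (d - 1) ≤ 2 * d * δ * (4 * (N : ℝ)) ^ (d - 1) := by
  have h := (le_real_boxCrossing_criticalProbI_of_le hd hL hLN).trans hδ
  have hN0 : (0 : ℝ) < 4 * N := by
    have : (0 : ℝ) < N := by exact_mod_cast (lt_of_lt_of_le hL hLN)
    linarith
  have hd0 : (0 : ℝ) < 2 * d := by
    have : (0 : ℝ) < d := by exact_mod_cast (lt_of_lt_of_le (by norm_num : 0 < 2) hd)
    linarith
  rw [div_pow, ← div_eq_inv_mul, div_le_iff₀ hd0, div_le_iff₀ (pow_pos hN0 _)] at h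
  linarith

/-- **Fixed aspect ratio `λ`:** for `d ≥ 2`, every `λ ≥ 1` and every `n ≥ 1`,
`(2d)⁻¹ (4λ)^{-(d-1)} ≤ P_{p_c}(Λ(n) ↔ ∂ⁱⁿΛ(λ n) in Λ(λ n))` — the annulus events of every aspect ratio
are crossed with probability bounded below uniformly in the scale, polynomially in the aspect ratio.
[cite: Kesten1982, Cor. 5.1] -/
theorem le_real_boxCrossing_mul_criticalProbI (hd : 2 ≤ d) {lam n : ℕ} (hlam : 1 ≤ lam) (hn : 1 ≤ n) :
    (2 * (d : ℝ))⁻¹ * ((4 * (lam : ℝ)) ^ (d - 1))⁻¹ ≤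
      (bondPercolation (zdGraph d) (criticalProbI d)).real (boxCrossing d n (lam * n)) := by
  have h := le_real_boxCrossing_criticalProbI_of_le hd hn (Nat.le_mul_of_pos_left n hlam)
  have hn0 : (n : ℝ) ≠ 0 := by exact_mod_cast (by omega : n ≠ 0)
  have heq : ((n : ℝ) / (4 * ((lam * n : ℕ) : ℝ))) = (4 * (lam : ℝ))⁻¹ := by
    push_cast
    field_simp
  rwa [heq, inv_pow] at h

/-- **`d = 3`:** for all `1 ≤ L ≤ N`, `(L/N)²/96 ≤ P_{p_c(ℤ³)}(Λ(L) ↔ ∂ⁱⁿΛ(N) in Λ(N))`.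
[cite: Kesten1982, Cor. 5.1] -/
theorem le_real_boxCrossing_criticalProbI_three_of_le {L N : ℕ} (hL : 1 ≤ L) (hLN : L ≤ N) :
    ((L : ℝ) / N) ^ 2 / 96 ≤
      (bondPercolation (zdGraph 3) (criticalProbI 3)).real (boxCrossing 3 L N) := by
  have h := le_real_boxCrossing_criticalProbI_of_le (d := 3) (by norm_num) hL hLN
  have hN0 : (N : ℝ) ≠ 0 := by exact_mod_cast (by omega : N ≠ 0)
  have heq : (2 * ((3 : ℕ) : ℝ))⁻¹ * ((L : ℝ) / (4 * N)) ^ (3 - 1) = ((L : ℝ) / N) ^ 2 / 96 := by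
    norm_num
    field_simp
    ring
  rwa [heq] at h

/-- **`d = 3`, fixed aspect ratio:** `1/(96 λ²) ≤ P_{p_c(ℤ³)}(Λ(n) ↔ ∂ⁱⁿΛ(λ n) in Λ(λ n))` for all
`λ, n ≥ 1`; `λ = 4` recovers (and improves the constant of) the tree's window `85^{-3}`, and `λ = 2`
the events of X_B = `CritAnnulusNonCrossing` (whose UPPER bound `≤ 1 - c` is the open route item
stmt-CriticalPhenomena-0846). [cite: Kesten1982, Cor. 5.1] -/
theorem le_real_boxCrossing_mul_criticalProbI_three {lam n : ℕ} (hlam : 1 ≤ lam) (hn : 1 ≤ n) :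
    (96 * (lam : ℝ) ^ 2)⁻¹ ≤
      (bondPercolation (zdGraph 3) (criticalProbI 3)).real (boxCrossing 3 n (lam * n)) := by
  have h := le_real_boxCrossing_criticalProbI_three_of_le hn (Nat.le_mul_of_pos_left n hlam)
  have hn0 : (n : ℝ) ≠ 0 := by exact_mod_cast (by omega : n ≠ 0)
  have heq : (((n : ℝ) / ((lam * n : ℕ) : ℝ)) ^ 2 / 96) = (96 * (lam : ℝ) ^ 2)⁻¹ := by
    push_cast
    field_simp
  rwa [heq] at h

end Rsw3

end Summit.CriticalPhenomena.PercolationContinuityZ3.Theorems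

end
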